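import Literature.Analysis.FluidPDE.TorusLinearisedNSVDataLimits
import Literature.Analysis.FunctionSpaces.TorusLinearisedNSExistence
import HarnessLib

/-!
# Limits of solutions of the linearised Navier–Stokes equation on `T^d` solve the equation:
# restart windows from the smooth limit slices and locality in time

Analysis/FluidPDE proof file (theorems only; no definitions, no named facts): the IDENTIFICATION
STEP of the construction of solutions of the linearised Navier–Stokes equation
`∂ₜw + (u·∇)w + (w·∇)u = νΔw − ∇q`, `div w = 0` (Constantin–Foias 1988, Ch. 14, (14.2)–(14.4))
from `V`-data by smooth approximation — the LINEAR twin of `TorusNSVDataExistenceWindows`, much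
simpler because the equation is linear and globally solvable from smooth data
(`Torus.linearisedNS_exists`). Let `u` be jointly smooth on `[a, b] × T^d` with divergence-free
slices, `(w_N, q_N)` jointly smooth solutions of the linearised equation along `u` on `[a, b]` with
divergence-free velocities, and `w̃` a family of smooth divergence-free mean-zero slices on `(a, b]`
with `w_N(t) → w̃(t)` in `H¹` for every `t ∈ (a, b]` (the output of
`Torus.linearisedNS_exists_limit_slices`). Then (`Torus.linearisedNS_exists_pressure_of_limit_slices`)
`w̃` is jointly smooth on `(a, b] × T^d` and there is a jointly smooth mean-zero pressure `p` with
`∂ₜw̃ + (u·∇)w̃ + (w̃·∇)u = νΔw̃ − ∇p` on `(a, b]` (one-sided time derivative within `(a, b]`).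

THE ARGUMENT. (1) Windows: for `s ∈ (a, b)` solve the linearised equation on `[s, b]` from the
smooth slice `w̃(s)` (`Torus.linearisedNS_exists`, mean-zero pressure `Q_s`); by linearity
`w_N − W_s` solves the same equation on `[s, b]`, so the exponential `H¹` bound
(`Torus.linearisedNS_exists_h1GrowthRate`) and `w_N(s) → w̃(s)` give `w_N(r) → W_s(r)` in `L²`,
whence `W_s(r) = w̃(r)` on `[s, b]` (`Torus.eq_of_tendsto_integral_norm_sub_sq`). (2) The mean-zero
pressures of two windows agree on the overlap (`Torus.linearisedNS_pressure_sub_eq`,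
`Torus.eq_of_forall_sub_eq_of_hasZeroMean`), so `p(r) = Q_{(a+r)/2}(r)` agrees with `Q_s` on
`(s, b]` for every `s`. (3) Locality: joint smoothness on `(a, b]` and the time derivative within
`(a, b]` are read off the windows (`Torus.isSmoothSpaceTimeOn_Ioc_of_forall_exists_window`,
`Torus.timeDerivWithin_Ioc_eq_of_window`).

## Tree search

Reused: `Torus.linearisedNS_exists` (`TorusLinearisedNSExistence`), `Torus.linearisedNS_sub_eq`
(`TorusLinearisedNSEnergy`), `Torus.linearisedNS_mono`, `Torus.linearisedNS_pressure_sub_eq`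
(`TorusLinearisedNSGrowth`), `Torus.eq_of_tendsto_integral_norm_sub_sq` (`TorusNSVDataExistenceLimits`),
the tools of `TorusLinearisedNSVDataLimits`. The pattern is
`Torus.IsClassicalNSSolutionOn.exists_pressure_of_limit_slices` (`TorusNSVDataExistenceWindows`).

## References

* P. Constantin, C. Foias, *Navier–Stokes Equations*, Univ. Chicago Press 1988, Ch. 14,
  (14.2)–(14.4), Lemma 14.3. [ConstantinFoiasNSE1988]
* J. C. Robinson, J. L. Rodrigo, W. Sadowski, *The Three-Dimensional Navier–Stokes Equations*,
  CUP 2016, Thm 6.8, §8.1. [RobinsonRodrigoSadowskiCUP2016]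
-/

noncomputable section

open MeasureTheory Set Function Filter UnitAddTorus
open scoped ContDiff InnerProductSpace Topology ENNReal

namespace Literature.Analysis.FluidPDE

open Literature.Analysis.FunctionSpaces

variable {d : Type*} [Fintype d] [DecidableEq d]

/-- **Limits of solutions of the linearised Navier–Stokes equation solve the equation on `(a, b]`.**
On `T^d` let `ν > 0`, `a < b`, `u` jointly smooth on `[a, b] × T^d` with divergence-free slices,
`(w_N, q_N)` jointly smooth on `[a, b] × T^d` with `div w_N(t) = 0` solving
`∂ₜw_N + (u·∇)w_N + (w_N·∇)u = νΔw_N − ∇q_N` (one-sided time derivative within `[a, b]`), and `w̃`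
with smooth, divergence-free, mean-zero slices on `(a, b]` such that
`∫ ‖w_N(t) − w̃(t)‖² + ‖∇(w_N(t) − w̃(t))‖₂² → 0` for every `t ∈ (a, b]`. Then `w̃` is jointly smooth
on `(a, b] × T^d` and there is a jointly smooth pressure `p` with mean-zero slices such that
`∂ₜw̃ + (u·∇)w̃ + (w̃·∇)u = νΔw̃ − ∇p` pointwise on `(a, b]` (one-sided time derivative within
`(a, b]`): restart the linear equation from the smooth slices `w̃(s)` (`Torus.linearisedNS_exists`),
identify by the exponential `H¹` bound of the difference and uniqueness of `L²` limits, normalise the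
pressures by zero mean, and use locality in time (Constantin–Foias 1988, Ch. 14; the linear twin of
Robinson–Rodrigo–Sadowski 2016, Thm 6.8 with §8.1). [cite: ConstantinFoiasNSE1988, Ch. 14 (14.3)] -/
theorem Torus.linearisedNS_exists_pressure_of_limit_slices {ν : ℝ} (hν : 0 < ν) {a b : ℝ} (hab : a < b)
    {u : ℝ → UnitAddTorus d → EuclideanSpace ℝ d}
    (hu : Torus.IsSmoothSpaceTimeOn (Icc a b) u) (hudiv : ∀ t ∈ Icc a b, Torus.IsDivFree (u t))
    {w : ℕ → ℝ → UnitAddTorus d → EuclideanSpace ℝ d} {q : ℕ → ℝ → UnitAddTorus d → ℝ}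
    (hw : ∀ N, Torus.IsSmoothSpaceTimeOn (Icc a b) (w N))
    (hq : ∀ N, Torus.IsSmoothSpaceTimeOn (Icc a b) (q N))
    (hwdiv : ∀ N, ∀ t ∈ Icc a b, Torus.IsDivFree (w N t))
    (hlin : ∀ N, ∀ t ∈ Icc a b, ∀ x, Torus.timeDerivWithin (Icc a b) (w N) t x +
      Torus.convect (u t) (w N t) x + Torus.convect (w N t) (u t) x =
        ν • Torus.laplacian (w N t) x - Torus.gradient (q N t) x)
    {wl : ℝ → UnitAddTorus d → EuclideanSpace ℝ d} (hwls : ∀ t ∈ Ioc a b, Torus.IsSmooth (wl t))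
    (hwldiv : ∀ t ∈ Ioc a b, Torus.IsDivFree (wl t)) (hwlmean : ∀ t ∈ Ioc a b, Torus.HasZeroMean (wl t))
    (hconv : ∀ t ∈ Ioc a b, Tendsto (fun N => (∫ x, ‖w N t x - wl t x‖ ^ 2) +
      Torus.gradNormSq (fun x => w N t x - wl t x)) atTop (𝓝 0)) :
    ∃ p : ℝ → UnitAddTorus d → ℝ, Torus.IsSmoothSpaceTimeOn (Ioc a b) wl ∧
      Torus.IsSmoothSpaceTimeOn (Ioc a b) p ∧ (∀ t ∈ Ioc a b, Torus.HasZeroMean (p t)) ∧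
      ∀ t ∈ Ioc a b, ∀ x, Torus.timeDerivWithin (Ioc a b) wl t x + Torus.convect (u t) (wl t) x +
        Torus.convect (wl t) (u t) x = ν • Torus.laplacian (wl t) x - Torus.gradient (p t) x := by
  obtain ⟨K, hK0, hK⟩ := Torus.linearisedNS_exists_h1GrowthRate hν hab hu hudiv
  have hws : ∀ N, ∀ t ∈ Icc a b, Torus.IsSmooth (w N t) := fun N t ht => (hw N).isSmooth_slice ht
  -- Step 1: the windows `[s, b]`, `s ∈ (a, b)`, and their identification with the limit slices
  have hwin : ∀ s ∈ Ioo a b, ∃ (W : ℝ → UnitAddTorus d → EuclideanSpace ℝ d) (Q : ℝ → UnitAddTorus d → ℝ),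
      Torus.IsSmoothSpaceTimeOn (Icc s b) W ∧ Torus.IsSmoothSpaceTimeOn (Icc s b) Q ∧
      (∀ r ∈ Icc s b, Torus.HasZeroMean (Q r)) ∧
      (∀ r ∈ Icc s b, ∀ x, Torus.timeDerivWithin (Icc s b) W r x + Torus.convect (u r) (W r) x +
        Torus.convect (W r) (u r) x = ν • Torus.laplacian (W r) x - Torus.gradient (Q r) x) ∧
      ∀ r ∈ Icc s b, W r = wl r := by
    intro s hs
    have hsI : s ∈ Ioc a b := ⟨hs.1, hs.2.le⟩
    have hsub : Icc s b ⊆ Icc a b := Icc_subset_Icc hs.1.le le_rfl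
    have hU : UniqueDiffOn ℝ (Icc s b) := uniqueDiffOn_Icc hs.2
    obtain ⟨W, Q, hW, hQ, hWdiv, -, hQmean, hWlin, hWs⟩ :=
      Torus.linearisedNS_exists hν hs.2 (hu.mono hsub) (fun r hr => hudiv r (hsub hr)) (hwls s hsI)
        (hwldiv s hsI) (hwlmean s hsI)
    refine ⟨W, Q, hW, hQ, hQmean, hWlin, fun r hr => ?_⟩
    have hrI : r ∈ Ioc a b := ⟨hs.1.trans_le hr.1, hr.2⟩
    -- `w_N - W` solves the linearised equation on `[s, b]`
    have hlinN : ∀ N, ∀ t ∈ Icc s b, ∀ x, Torus.timeDerivWithin (Icc s b) (w N) t x +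
        Torus.convect (u t) (w N t) x + Torus.convect (w N t) (u t) x =
          ν • Torus.laplacian (w N t) x - Torus.gradient (q N t) x := fun N t ht x =>
      Torus.linearisedNS_mono (hw N) (hlin N) hsub hU ht x
    have hdiff : ∀ N, (∫ x, ‖w N r x - W r x‖ ^ 2) + Torus.gradNormSq (fun x => w N r x - W r x) ≤
        ((∫ x, ‖w N s x - wl s x‖ ^ 2) + Torus.gradNormSq (fun x => w N s x - wl s x)) *
          Real.exp (K * (r - s)) := by
      intro N
      have hdiv : ∀ t ∈ Icc s b, Torus.IsDivFree (fun y => w N t y - W t y) := by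
        intro t ht x
        rw [show (fun y => w N t y - W t y) = w N t - W t from rfl,
          Torus.divergence_sub (((hw N).isSmooth_slice (hsub ht)).isContDiff (by simp))
            ((hW.isSmooth_slice ht).isContDiff (by simp)), hwdiv N t (hsub ht) x, hWdiv t ht x, sub_zero]
      have h := hK hs.1.le (((hw N).mono hsub).sub hW) (((hq N).mono hsub).sub hQ) hdiv
        (fun t ht x => Torus.linearisedNS_sub_eq ((hw N).mono hsub) ((hq N).mono hsub) (hlinN N) hW hQ
          hWlin hs.2 ht x) r hr
      rw [hWs] at h
      exact h
    -- hence `w_N(r) → W(r)` in `L²`, and `W(r)` is the limit slice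
    have hlim : Tendsto (fun N => ((∫ x, ‖w N s x - wl s x‖ ^ 2) +
        Torus.gradNormSq (fun x => w N s x - wl s x)) * Real.exp (K * (r - s))) atTop (𝓝 0) := by
      simpa using (hconv s hsI).mul_const (Real.exp (K * (r - s)))
    have hL2W : Tendsto (fun N => ∫ x, ‖w N r x - W r x‖ ^ 2) atTop (𝓝 0) :=
      tendsto_of_tendsto_of_tendsto_of_le_of_le tendsto_const_nhds hlim
        (fun N => integral_nonneg fun x => sq_nonneg _)
        (fun N => (le_add_of_nonneg_right (Torus.gradNormSq_nonneg _)).trans (hdiff N))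
    have hL2l : Tendsto (fun N => ∫ x, ‖w N r x - wl r x‖ ^ 2) atTop (𝓝 0) :=
      tendsto_of_tendsto_of_tendsto_of_le_of_le tendsto_const_nhds (hconv r hrI)
        (fun N => integral_nonneg fun x => sq_nonneg _)
        (fun N => le_add_of_nonneg_right (Torus.gradNormSq_nonneg _))
    exact Torus.eq_of_tendsto_integral_norm_sub_sq (v := fun N => w N r) (fun N => hws N r (hsub hr))
      (hW.isSmooth_slice hr) (hwls r hrI) hL2W hL2l
  choose! W Q hW hQ hQmean hWlin hWeq using hwin
  -- Step 2: the mean-zero pressures of two windows agree on the overlap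
  have hQQ : ∀ s ∈ Ioo a b, ∀ s' ∈ Ioo a b, ∀ r ∈ Icc (max s s') b, Q s r = Q s' r := by
    intro s hs s' hs' r hr
    have hm : max s s' < b := max_lt hs.2 hs'.2
    have hsub : Icc (max s s') b ⊆ Icc s b := Icc_subset_Icc (le_max_left _ _) le_rfl
    have hsub' : Icc (max s s') b ⊆ Icc s' b := Icc_subset_Icc (le_max_right _ _) le_rfl
    have hU : UniqueDiffOn ℝ (Icc (max s s') b) := uniqueDiffOn_Icc hm
    have h1 : ∀ t ∈ Icc (max s s') b, ∀ x, Torus.timeDerivWithin (Icc (max s s') b) (W s) t x +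
        Torus.convect (u t) (W s t) x + Torus.convect (W s t) (u t) x =
          ν • Torus.laplacian (W s t) x - Torus.gradient (Q s t) x := fun t ht x =>
      Torus.linearisedNS_mono (hW s hs) (hWlin s hs) hsub hU ht x
    have h2 : ∀ t ∈ Icc (max s s') b, ∀ x, Torus.timeDerivWithin (Icc (max s s') b) (W s') t x +
        Torus.convect (u t) (W s' t) x + Torus.convect (W s' t) (u t) x =
          ν • Torus.laplacian (W s' t) x - Torus.gradient (Q s' t) x := fun t ht x =>
      Torus.linearisedNS_mono (hW s' hs') (hWlin s' hs') hsub' hU ht x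
    have heq : ∀ t ∈ Icc (max s s') b, W s t = W s' t := fun t ht => by
      rw [hWeq s hs t (hsub ht), hWeq s' hs' t (hsub' ht)]
    have hinc := Torus.linearisedNS_pressure_sub_eq ((hQ s hs).mono hsub) ((hQ s' hs').mono hsub') h1 h2
      heq hr
    exact Torus.eq_of_forall_sub_eq_of_hasZeroMean ((hQ s hs).isSmooth_slice (hsub hr)).integrable
      ((hQ s' hs').isSmooth_slice (hsub' hr)).integrable (hQmean s hs r (hsub hr))
      (hQmean s' hs' r (hsub' hr)) hinc
  -- Step 3: the pressure, read off the window starting at the midpoint `(a + r)/2`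
  set p : ℝ → UnitAddTorus d → ℝ := fun r => Q ((a + r) / 2) r with hp_def
  have hmid : ∀ t ∈ Ioc a b, (a + t) / 2 ∈ Ioo a b ∧ (a + t) / 2 < t := fun t ht =>
    ⟨⟨by linarith [ht.1], by linarith [ht.1, ht.2]⟩, by linarith [ht.1]⟩
  have hpQ : ∀ s ∈ Ioo a b, ∀ r ∈ Ioc s b, p r = Q s r := by
    intro s hs r hr
    have hrI : r ∈ Ioc a b := ⟨hs.1.trans hr.1, hr.2⟩
    exact hQQ _ (hmid r hrI).1 s hs r ⟨max_le (hmid r hrI).2.le hr.1.le, hr.2⟩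
  refine ⟨p, ?_, ?_, fun t ht => hQmean _ (hmid t ht).1 t ⟨(hmid t ht).2.le, ht.2⟩, fun t ht x => ?_⟩
  · -- joint smoothness of the velocity
    refine Torus.isSmoothSpaceTimeOn_Ioc_of_forall_exists_window fun t ht => ?_
    exact ⟨(a + t) / 2, (hmid t ht).1.1.le, (hmid t ht).2, W ((a + t) / 2), hW _ (hmid t ht).1,
      fun r hr => hWeq _ (hmid t ht).1 r (Ioc_subset_Icc_self hr)⟩
  · -- joint smoothness of the pressure
    refine Torus.isSmoothSpaceTimeOn_Ioc_of_forall_exists_window fun t ht => ?_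
    exact ⟨(a + t) / 2, (hmid t ht).1.1.le, (hmid t ht).2, Q ((a + t) / 2), hQ _ (hmid t ht).1,
      fun r hr => (hpQ _ (hmid t ht).1 r hr).symm⟩
  · -- the equation at `t`, read off the window starting at `(a + t)/2`
    set s : ℝ := (a + t) / 2 with hs_def
    have hs : s ∈ Ioo a b := (hmid t ht).1
    have hst : s < t := (hmid t ht).2
    have htw : t ∈ Icc s b := ⟨hst.le, ht.2⟩
    rw [Torus.timeDerivWithin_Ioc_eq_of_window hs.1.le hst ht.2 (hW s hs)
      (fun r hr => hWeq s hs r (Ioc_subset_Icc_self hr)) x, hpQ s hs t ⟨hst, ht.2⟩, ← hWeq s hs t htw]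
    exact hWlin s hs t htw x

end Literature.Analysis.FluidPDE

end
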